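import Mathlib
import HarnessLib

/-!
# Stability of the zero count in a continuous family (shooting method, generic part)

THIS IS NOT AN RH STATEMENT.  For a family of functions `x ↦ U χ x` on `[0, λ]`, jointly continuous
in `(χ, x)` together with the `x`-derivative `U₁ χ x`, whose member `U χ₀` has only simple zeros and
does not vanish at `λ`, we prove the local behaviour of the number `N(χ)` of zeros in the open interval
`(0, λ)` for `χ` near `χ₀` (`zeros_ncard_near`):

* if `U χ₀ 0 ≠ 0` then `N(χ) = N(χ₀)`;
* if `U χ₀ 0 = 0` then `N(χ) = N(χ₀)` when `U χ 0` has the sign of `∂ₓU χ₀ 0` (or vanishes), and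
  `N(χ) = N(χ₀) + 1` when it has the opposite sign (one zero enters through the end point `0`).

This is the counting step of the classical shooting argument for Sturm–Liouville eigenfunctions.
References: [Coddington–Levinson 1955, Ch. 8 §2 (proof of Thm 2.1)]; [Hartman 2002, Ch. XI §4].
-/

noncomputable section

open Real Set Filter Topology

namespace Literature.NumberTheory.LFunctions

/-! ### Small helpers -/

/-- A positive function on a finite set has a positive lower bound. [folklore] -/
theorem exists_pos_forall_le {α : Type*} {F : Set α} (hF : F.Finite) {g : α → ℝ}
    (hg : ∀ z ∈ F, 0 < g z) : ∃ η > 0, ∀ z ∈ F, η ≤ g z := by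
  rcases F.eq_empty_or_nonempty with rfl | hne
  · exact ⟨1, one_pos, by simp⟩
  · obtain ⟨z₀, hz₀, hmin⟩ := F.exists_min_image g hF hne
    exact ⟨g z₀, hg z₀ hz₀, hmin⟩

/-- If `a` is closer to `s` than `|s|`, then `a` has the sign of `s`. [folklore] -/
theorem mul_pos_of_abs_sub_lt {a s : ℝ} (h : |a - s| < |s|) : 0 < s * a := by
  rcases lt_trichotomy s 0 with hs | hs | hs
  · rw [abs_of_neg hs] at h
    have := (abs_lt.mp h).2
    nlinarith
  · rw [hs, abs_zero] at h; exact absurd h (abs_nonneg _).not_gt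
  · rw [abs_of_pos hs] at h
    have := (abs_lt.mp h).1
    nlinarith

/-- Sign transfer: `u` has the sign of `u₀`, and `s u₀ < 0`, hence `s u < 0`. [folklore] -/
theorem mul_neg_of_mul_pos_of_mul_neg {s u₀ u : ℝ} (h1 : 0 < u₀ * u) (h2 : s * u₀ < 0) :
    s * u < 0 := by
  have hu₀ : u₀ ≠ 0 := by rintro rfl; simp at h1
  have h3 : 0 < u₀ * u₀ := mul_self_pos.mpr hu₀
  have : s * u * (u₀ * u₀) = s * u₀ * (u₀ * u) := by ring
  nlinarith

/-- Sign transfer: `u` has the sign of `u₀`, and `0 < s u₀`, hence `0 < s u`. [folklore] -/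
theorem mul_pos_of_mul_pos_of_mul_pos {s u₀ u : ℝ} (h1 : 0 < u₀ * u) (h2 : 0 < s * u₀) :
    0 < s * u := by
  have hu₀ : u₀ ≠ 0 := by rintro rfl; simp at h1
  have h3 : 0 < u₀ * u₀ := mul_self_pos.mpr hu₀
  have : s * u * (u₀ * u₀) = s * u₀ * (u₀ * u) := by ring
  nlinarith

/-- A function with positive derivative at every point of a convex set is strictly increasing there.
[folklore] -/
theorem strictMonoOn_of_hasDerivAt_pos' {f f' : ℝ → ℝ} {D : Set ℝ} (hD : Convex ℝ D)
    (hf : ∀ x ∈ D, HasDerivAt f (f' x) x) (hpos : ∀ x ∈ D, 0 < f' x) : StrictMonoOn f D :=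
  strictMonoOn_of_deriv_pos hD (fun x hx ↦ (hf x hx).continuousAt.continuousWithinAt)
    fun x hx ↦ by
      rw [(hf x (interior_subset hx)).deriv]
      exact hpos x (interior_subset hx)

/-! ### The zero count near a parameter value -/

/-- **Local behaviour of the zero count.**  See the module docstring.  Hypotheses: joint continuity
of `U` and of the `x`-derivative `U₁` on `[χ₀−1, χ₀+1] × [0, λ]`; `U χ₀` has only simple zeros in
`[0, λ]`, finitely many, and `U χ₀ λ ≠ 0`; each `U χ` has finitely many zeros in `(0, λ)`.
[cite: CoddingtonLevinson1955, Ch. 8 §2 Thm 2.1 (proof); Hartman2002, Ch. XI §4] -/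
theorem zeros_ncard_near {U U₁ : ℝ → ℝ → ℝ} {lam χ₀ : ℝ} (hlam : 0 < lam)
    (hU : ContinuousOn (fun p : ℝ × ℝ ↦ U p.1 p.2) (Icc (χ₀ - 1) (χ₀ + 1) ×ˢ Icc 0 lam))
    (hU₁ : ContinuousOn (fun p : ℝ × ℝ ↦ U₁ p.1 p.2) (Icc (χ₀ - 1) (χ₀ + 1) ×ˢ Icc 0 lam))
    (hd : ∀ χ ∈ Icc (χ₀ - 1) (χ₀ + 1), ∀ x ∈ Icc 0 lam, HasDerivAt (U χ) (U₁ χ x) x)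
    (hsimple : ∀ x ∈ Icc 0 lam, U χ₀ x = 0 → U₁ χ₀ x ≠ 0)
    (hF : {x | x ∈ Icc 0 lam ∧ U χ₀ x = 0}.Finite)
    (hfin : ∀ χ ∈ Icc (χ₀ - 1) (χ₀ + 1), {x | x ∈ Ioo 0 lam ∧ U χ x = 0}.Finite)
    (hl : U χ₀ lam ≠ 0) :
    ∃ ε > 0, ∀ χ, |χ - χ₀| < ε →
      (U χ₀ 0 ≠ 0 →
        {x | x ∈ Ioo 0 lam ∧ U χ x = 0}.ncard = {x | x ∈ Ioo 0 lam ∧ U χ₀ x = 0}.ncard) ∧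
      (U χ₀ 0 = 0 →
        (0 ≤ U₁ χ₀ 0 * U χ 0 →
          {x | x ∈ Ioo 0 lam ∧ U χ x = 0}.ncard = {x | x ∈ Ioo 0 lam ∧ U χ₀ x = 0}.ncard) ∧
        (U₁ χ₀ 0 * U χ 0 < 0 →
          {x | x ∈ Ioo 0 lam ∧ U χ x = 0}.ncard
            = {x | x ∈ Ioo 0 lam ∧ U χ₀ x = 0}.ncard + 1)) := by
  set F : Set ℝ := {x | x ∈ Icc 0 lam ∧ U χ₀ x = 0} with hFdef
  set F₀ : Set ℝ := {x | x ∈ Ioo 0 lam ∧ U χ₀ x = 0} with hF₀def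
  set R : Set (ℝ × ℝ) := Icc (χ₀ - 1) (χ₀ + 1) ×ˢ Icc 0 lam with hRdef
  have hRc : IsCompact R := isCompact_Icc.prod isCompact_Icc
  have hχ₀ : χ₀ ∈ Icc (χ₀ - 1) (χ₀ + 1) := ⟨by linarith, by linarith⟩
  have hF₀F : F₀ ⊆ F := fun x hx ↦ ⟨Ioo_subset_Icc_self hx.1, hx.2⟩
  have hF₀f : F₀.Finite := hF.subset hF₀F
  have hlamF : lam ∉ F := fun h ↦ hl h.2
  have hmemR : ∀ {c x : ℝ}, c ∈ Icc (χ₀ - 1) (χ₀ + 1) → x ∈ Icc 0 lam → (c, x) ∈ R :=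
    fun hc hx ↦ mk_mem_prod hc hx
  -- Step 1: a uniform lower bound for `|∂ₓU χ₀|` at the zeros
  obtain ⟨η, hη, hηF⟩ : ∃ η > 0, ∀ z ∈ F, η ≤ |U₁ χ₀ z| :=
    exists_pos_forall_le hF fun z hz ↦ abs_pos.mpr (hsimple z hz.1 hz.2)
  -- Step 2: uniform continuity of `U₁`
  obtain ⟨δ₁, hδ₁, hδ₁U⟩ := Metric.uniformContinuousOn_iff.mp
    (hRc.uniformContinuousOn_of_continuous hU₁) (η / 4) (by positivity)
  -- Step 3: the radius `δ`
  obtain ⟨η₂, hη₂, hη₂F⟩ : ∃ η₂ > 0, ∀ z ∈ F, η₂ ≤ |lam - z| :=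
    exists_pos_forall_le hF fun z hz ↦ abs_pos.mpr (sub_ne_zero.mpr fun h ↦ hlamF (by
      rw [h]; exact hz))
  obtain ⟨η₃, hη₃, hη₃F⟩ : ∃ η₃ > 0, ∀ z ∈ F₀, η₃ ≤ z :=
    exists_pos_forall_le hF₀f fun z hz ↦ hz.1.1
  obtain ⟨δ, hδ, hδ₁', hδη₂, hδη₃⟩ : ∃ δ > 0, 4 * δ ≤ δ₁ ∧ δ ≤ η₂ ∧ δ ≤ η₃ :=
    ⟨min (δ₁ / 4) (min η₂ η₃), lt_min (by positivity) (lt_min hη₂ hη₃),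
      by linarith [min_le_left (δ₁ / 4) (min η₂ η₃)],
      (min_le_right _ _).trans (min_le_left _ _), (min_le_right _ _).trans (min_le_right _ _)⟩
  -- Step 4: the compact set `K` away from the zeros, and the lower bound `m` of `|U χ₀|` there
  set K : Set ℝ := Icc 0 lam ∩ ⋂ z ∈ F, {x | δ ≤ |x - z|} with hKdef
  have hKc : IsCompact K := isCompact_Icc.inter_right
    (isClosed_biInter fun z _ ↦ isClosed_le continuous_const (by fun_prop))
  have hmemK : ∀ {x}, x ∈ K ↔ x ∈ Icc 0 lam ∧ ∀ z ∈ F, δ ≤ |x - z| := by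
    intro x; simp only [hKdef, mem_inter_iff, mem_iInter₂, mem_setOf_eq]
  have hcont : ∀ c ∈ Icc (χ₀ - 1) (χ₀ + 1), ContinuousOn (U c) (Icc 0 lam) :=
    fun c hc x hx ↦ (hd c hc x hx).continuousAt.continuousWithinAt
  have hKF : ∀ x ∈ K, U χ₀ x ≠ 0 := by
    intro x hx h0
    have := (hmemK.mp hx).2 x ⟨(hmemK.mp hx).1, h0⟩
    simp only [sub_self, abs_zero] at this
    linarith
  obtain ⟨m, hm, hmK⟩ : ∃ m > 0, ∀ x ∈ K, m ≤ |U χ₀ x| := by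
    rcases K.eq_empty_or_nonempty with hK | hK
    · exact ⟨1, one_pos, by simp [hK]⟩
    · obtain ⟨x₀, hx₀, hmin⟩ := hKc.exists_isMinOn hK
        ((continuous_abs.comp_continuousOn (hcont χ₀ hχ₀)).mono fun x hx ↦ (hmemK.mp hx).1)
      exact ⟨|U χ₀ x₀|, abs_pos.mpr (hKF x₀ hx₀), fun x hx ↦ isMinOn_iff.mp hmin x hx⟩
  -- Step 5: uniform continuity of `U`, and `ε`
  obtain ⟨δ₀, hδ₀, hδ₀U⟩ := Metric.uniformContinuousOn_iff.mp
    (hRc.uniformContinuousOn_of_continuous hU) m hm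
  refine ⟨min (1 / 2) (min δ₀ δ₁), lt_min (by norm_num) (lt_min hδ₀ hδ₁), fun χ hχ ↦ ?_⟩
  have hχ1 : |χ - χ₀| < 1 / 2 := lt_of_lt_of_le hχ (min_le_left _ _)
  have hχδ₀ : |χ - χ₀| < δ₀ := lt_of_lt_of_le hχ ((min_le_right _ _).trans (min_le_left _ _))
  have hχδ₁ : |χ - χ₀| < δ₁ := lt_of_lt_of_le hχ ((min_le_right _ _).trans (min_le_right _ _))
  have hχmem : χ ∈ Icc (χ₀ - 1) (χ₀ + 1) := by
    constructor <;> linarith [(abs_lt.mp hχ1).1, (abs_lt.mp hχ1).2]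
  set Zχ : Set ℝ := {x | x ∈ Ioo 0 lam ∧ U χ x = 0} with hZχdef
  have hZχf : Zχ.Finite := hfin χ hχmem
  -- closeness of `U χ`, `U₁ χ` to `U χ₀`, `U₁ χ₀`, and continuity of `U₁ χ₀` in `x`
  have hclose : ∀ x ∈ Icc 0 lam, |U χ x - U χ₀ x| < m := by
    intro x hx
    have h := hδ₀U (χ, x) (hmemR hχmem hx) (χ₀, x) (hmemR hχ₀ hx) (by
      simp only [Prod.dist_eq, Real.dist_eq, sub_self, abs_zero]
      exact max_lt hχδ₀ hδ₀)
    simpa only [Real.dist_eq] using h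
  have hclose₁ : ∀ x ∈ Icc 0 lam, |U₁ χ x - U₁ χ₀ x| < η / 4 := by
    intro x hx
    have h := hδ₁U (χ, x) (hmemR hχmem hx) (χ₀, x) (hmemR hχ₀ hx) (by
      simp only [Prod.dist_eq, Real.dist_eq, sub_self, abs_zero]
      exact max_lt hχδ₁ hδ₁)
    simpa only [Real.dist_eq] using h
  have hnear₁ : ∀ x ∈ Icc 0 lam, ∀ z ∈ Icc 0 lam, |x - z| < δ₁ →
      |U₁ χ₀ x - U₁ χ₀ z| < η / 4 := by
    intro x hx z hz hxz
    have h := hδ₁U (χ₀, x) (hmemR hχ₀ hx) (χ₀, z) (hmemR hχ₀ hz) (by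
      simp only [Prod.dist_eq, Real.dist_eq, sub_self, abs_zero]
      exact max_lt hδ₁ hxz)
    simpa only [Real.dist_eq] using h
  -- (A) `U c` is strictly monotone near each zero of `U χ₀`, for `c = χ₀` and `c = χ`
  set J : ℝ → Set ℝ := fun z ↦ Icc 0 lam ∩ Ioo (z - δ₁) (z + δ₁) with hJdef
  have hJmem : ∀ z x : ℝ, x ∈ Icc 0 lam → |x - z| < δ₁ → x ∈ J z := fun z x hx hxz ↦
    ⟨hx, by constructor <;> linarith [(abs_lt.mp hxz).1, (abs_lt.mp hxz).2]⟩
  have hA : ∀ c ∈ Icc (χ₀ - 1) (χ₀ + 1), (∀ x ∈ Icc 0 lam, |U₁ c x - U₁ χ₀ x| < η / 4) →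
      ∀ z ∈ F, StrictMonoOn (fun x ↦ U₁ χ₀ z * U c x) (J z) := by
    intro c hc hcl z hz
    refine strictMonoOn_of_hasDerivAt_pos' ((convex_Icc 0 lam).inter (convex_Ioo _ _))
      (fun x hx ↦ (hd c hc x hx.1).const_mul _) fun x hx ↦ ?_
    apply mul_pos_of_abs_sub_lt
    have hxz : |x - z| < δ₁ := abs_lt.mpr ⟨by linarith [hx.2.1], by linarith [hx.2.2]⟩
    have h1 := hcl x hx.1
    have h2 := hnear₁ x hx.1 z hz.1 hxz
    have h3 := hηF z hz
    calc |U₁ c x - U₁ χ₀ z| = |(U₁ c x - U₁ χ₀ x) + (U₁ χ₀ x - U₁ χ₀ z)| := by ring_nf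
      _ ≤ |U₁ c x - U₁ χ₀ x| + |U₁ χ₀ x - U₁ χ₀ z| := abs_add_le _ _
      _ < |U₁ χ₀ z| := by linarith
  have hA₀ := hA χ₀ hχ₀ (fun x _ ↦ by simp only [sub_self, abs_zero]; positivity)
  have hAχ := hA χ hχmem hclose₁
  -- (B) separation of the zeros of `U χ₀`
  have hsep : ∀ z ∈ F, ∀ z' ∈ F, z ≠ z' → δ₁ ≤ |z - z'| := by
    intro z hz z' hz' hne
    by_contra hcon
    push Not at hcon
    have hz'J : z' ∈ J z := hJmem z z' hz'.1 (by rw [abs_sub_comm]; exact hcon)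
    have hzJ : z ∈ J z := hJmem z z hz.1 (by simp [hδ₁])
    exact hne ((hA₀ z hz).injOn hzJ hz'J (by simp only [hz.2, hz'.2]))
  -- (C) same sign as `U χ₀` on `K`
  have hsame : ∀ y ∈ K, 0 < U χ₀ y * U χ y := fun y hy ↦
    mul_pos_of_abs_sub_lt (lt_of_lt_of_le (hclose y (hmemK.mp hy).1) (hmK y hy))
  -- (D) upper bound: the zeros of `U χ` inject into `F`
  have hnear : ∀ x ∈ Zχ, ∃ z ∈ F, |x - z| < δ := by
    intro x hx
    by_contra hcon
    push Not at hcon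
    have hxK : x ∈ K := hmemK.mpr ⟨Ioo_subset_Icc_self hx.1, hcon⟩
    have h1 := hsame x hxK
    rw [hx.2, mul_zero] at h1
    exact lt_irrefl _ h1
  choose! φ hφF hφδ using hnear
  have hinjU : ∀ z ∈ F, InjOn (U χ) (J z) := by
    intro z hz x hx y hy hxy
    exact (hAχ z hz).injOn hx hy (by simp only [hxy])
  have hφinj : InjOn φ Zχ := by
    intro x hx y hy hxy
    have hzF := hφF x hx
    have hx' : x ∈ J (φ x) := hJmem _ x (Ioo_subset_Icc_self hx.1) (by linarith [hφδ x hx])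
    have hy' : y ∈ J (φ x) :=
      hJmem _ y (Ioo_subset_Icc_self hy.1) (by rw [hxy]; linarith [hφδ y hy])
    exact hinjU _ hzF hx' hy' (by rw [hx.2, hy.2])
  have hupper : Zχ.ncard ≤ F.ncard := ncard_le_ncard_of_injOn φ hφF hφinj hF
  -- (E) lower bound: each zero of `U χ₀` in `(0, λ)` persists
  have hpmK : ∀ z ∈ F₀, z - δ ∈ K ∧ z + δ ∈ K := by
    intro z hz
    have hzF : z ∈ F := hF₀F hz
    have h3 : δ ≤ z := hδη₃.trans (hη₃F z hz)
    have h2 : δ ≤ lam - z := by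
      have := hη₂F z hzF
      rw [abs_of_pos (by linarith [hz.1.2])] at this
      exact hδη₂.trans this
    have far : ∀ z' ∈ F, z' ≠ z → δ ≤ |z - δ - z'| ∧ δ ≤ |z + δ - z'| := by
      intro z' hz' hne
      have h := hsep z hzF z' hz' (Ne.symm hne)
      rcases le_abs.mp h with h | h
      · exact ⟨le_abs.mpr (Or.inl (by linarith)), le_abs.mpr (Or.inl (by linarith))⟩
      · exact ⟨le_abs.mpr (Or.inr (by linarith)), le_abs.mpr (Or.inr (by linarith))⟩
    constructor
    · refine hmemK.mpr ⟨⟨by linarith, by linarith [hz.1.2]⟩, fun z' hz' ↦ ?_⟩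
      by_cases hne : z' = z
      · rw [hne, show z - δ - z = -δ by ring, abs_neg, abs_of_pos hδ]
      · exact (far z' hz' hne).1
    · refine hmemK.mpr ⟨⟨by linarith [hz.1.1], by linarith⟩, fun z' hz' ↦ ?_⟩
      by_cases hne : z' = z
      · rw [hne, show z + δ - z = δ by ring, abs_of_pos hδ]
      · exact (far z' hz' hne).2
  have hlowerW : ∀ z ∈ F₀, ∃ ζ ∈ Ioo (z - δ) (z + δ), ζ ∈ Zχ := by
    intro z hz
    have hzF := hF₀F hz
    obtain ⟨hKm, hKp⟩ := hpmK z hz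
    have hs : U₁ χ₀ z ≠ 0 := hsimple z hzF.1 hzF.2
    have hm0 : z - δ ∈ Icc 0 lam := (hmemK.mp hKm).1
    have hp0 : z + δ ∈ Icc 0 lam := (hmemK.mp hKp).1
    have hzmJ : z - δ ∈ J z :=
      hJmem z _ hm0 (by rw [show z - δ - z = -δ by ring, abs_neg, abs_of_pos hδ]; linarith)
    have hzpJ : z + δ ∈ J z :=
      hJmem z _ hp0 (by rw [show z + δ - z = δ by ring, abs_of_pos hδ]; linarith)
    have hzJ : z ∈ J z := hJmem z z hzF.1 (by simp [hδ₁])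
    have hlt1 : U₁ χ₀ z * U χ₀ (z - δ) < U₁ χ₀ z * U χ₀ z := hA₀ z hzF hzmJ hzJ (by linarith)
    have hlt2 : U₁ χ₀ z * U χ₀ z < U₁ χ₀ z * U χ₀ (z + δ) := hA₀ z hzF hzJ hzpJ (by linarith)
    rw [hzF.2, mul_zero] at hlt1 hlt2
    have hm' : U₁ χ₀ z * U χ (z - δ) < 0 := mul_neg_of_mul_pos_of_mul_neg (hsame _ hKm) hlt1
    have hp' : 0 < U₁ χ₀ z * U χ (z + δ) := mul_pos_of_mul_pos_of_mul_pos (hsame _ hKp) hlt2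
    have hcontg : ContinuousOn (fun x ↦ U₁ χ₀ z * U χ x) (Icc (z - δ) (z + δ)) :=
      continuousOn_const.mul ((hcont χ hχmem).mono (Icc_subset_Icc hm0.1 hp0.2))
    obtain ⟨ζ, hζ, hgζ⟩ :=
      intermediate_value_Ioo (by linarith) hcontg (show (0 : ℝ) ∈ Ioo _ _ from ⟨hm', hp'⟩)
    refine ⟨ζ, hζ, ⟨⟨by linarith [hm0.1, hζ.1], by linarith [hp0.2, hζ.2]⟩, ?_⟩⟩
    exact (mul_eq_zero.mp hgζ).resolve_left hs
  choose! ζ hζI hζZ using hlowerW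
  have hζinj : InjOn ζ F₀ := by
    intro z hz z' hz' hzz
    by_contra hne
    have h := hsep z (hF₀F hz) z' (hF₀F hz') hne
    have h1 := hζI z hz
    have h2 := hζI z' hz'
    rw [hzz] at h1
    have : |z - z'| < 2 * δ :=
      abs_lt.mpr ⟨by linarith [h1.1, h2.2, h1.2, h2.1], by linarith [h1.1, h2.2, h1.2, h2.1]⟩
    linarith
  have hlower : F₀.ncard ≤ Zχ.ncard := ncard_le_ncard_of_injOn ζ hζZ hζinj hZχf
  -- (F) and (G): the two cases
  refine ⟨fun h0 ↦ ?_, fun h0 ↦ ?_⟩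
  · have hFF₀ : F = F₀ := by
      refine Subset.antisymm (fun x hx ↦ ⟨⟨?_, ?_⟩, hx.2⟩) hF₀F
      · exact lt_of_le_of_ne hx.1.1 fun h ↦ h0 (by have := hx.2; rwa [← h] at this)
      · exact lt_of_le_of_ne hx.1.2 fun h ↦ hlamF (by rw [← h]; exact hx)
    rw [hFF₀] at hupper
    exact le_antisymm hupper hlower
  · have h0F : (0 : ℝ) ∈ F := ⟨⟨le_rfl, hlam.le⟩, h0⟩
    have h0F₀ : (0 : ℝ) ∉ F₀ := fun h ↦ lt_irrefl _ h.1.1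
    have hFins : F = insert 0 F₀ := by
      refine Subset.antisymm (fun x hx ↦ ?_) (insert_subset h0F hF₀F)
      rcases hx.1.1.eq_or_lt with h | h
      · exact Or.inl h.symm
      · exact Or.inr ⟨⟨h, lt_of_le_of_ne hx.1.2 fun h' ↦ hlamF (by rw [← h']; exact hx)⟩, hx.2⟩
    have hFcard : F.ncard = F₀.ncard + 1 := by rw [hFins, ncard_insert_of_notMem h0F₀ hF₀f]
    have hs : U₁ χ₀ 0 ≠ 0 := hsimple 0 h0F.1 h0
    -- zeros of `U χ₀` other than `0` are far from `0`
    have hfar0 : ∀ z ∈ F₀, 4 * δ ≤ z := by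
      intro z hz
      have h := hsep 0 h0F z (hF₀F hz) (ne_of_lt hz.1.1)
      rw [zero_sub, abs_neg, abs_of_pos hz.1.1] at h
      linarith
    have hδlam : δ ≤ lam := by
      have := hη₂F 0 h0F
      rw [sub_zero, abs_of_pos hlam] at this
      exact hδη₂.trans this
    have hδIcc : δ ∈ Icc 0 lam := ⟨hδ.le, hδlam⟩
    have hδK : δ ∈ K := by
      refine hmemK.mpr ⟨hδIcc, fun z' hz' ↦ ?_⟩
      by_cases hne : z' = 0
      · rw [hne, sub_zero, abs_of_pos hδ]
      · have hz'0 : z' ∈ F₀ := by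
          rw [hFins] at hz'
          rcases hz' with h | h
          · exact absurd h hne
          · exact h
        have := hfar0 z' hz'0
        rw [abs_sub_comm, abs_of_pos (by linarith)]
        linarith
    have h0J : (0 : ℝ) ∈ J 0 := hJmem 0 0 h0F.1 (by simp [hδ₁])
    have hδJ : δ ∈ J 0 := hJmem 0 δ hδIcc (by rw [sub_zero, abs_of_pos hδ]; linarith)
    have hlt : U₁ χ₀ 0 * U χ₀ 0 < U₁ χ₀ 0 * U χ₀ δ := hA₀ 0 h0F h0J hδJ hδ
    rw [h0, mul_zero] at hlt
    have hδpos : 0 < U₁ χ₀ 0 * U χ δ := mul_pos_of_mul_pos_of_mul_pos (hsame δ hδK) hlt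
    refine ⟨fun hge ↦ ?_, fun hneg ↦ ?_⟩
    · -- no zero enters at `0`: `φ` maps into `F₀`
      have hφF₀ : ∀ x ∈ Zχ, φ x ∈ F₀ := by
        intro x hx
        have hφx := hφF x hx
        rw [hFins] at hφx
        rcases hφx with h | h
        · exfalso
          have hxδ : |x - 0| < δ := by simpa [h] using hφδ x hx
          have hxJ : x ∈ J 0 := hJmem 0 x (Ioo_subset_Icc_self hx.1) (by linarith)
          have := hAχ 0 h0F h0J hxJ hx.1.1
          simp only [hx.2, mul_zero] at this
          linarith
        · exact h
      have hupper' : Zχ.ncard ≤ F₀.ncard := ncard_le_ncard_of_injOn φ hφF₀ hφinj hF₀f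
      exact le_antisymm hupper' hlower
    · -- one zero enters at `0`
      have hcontg : ContinuousOn (fun x ↦ U₁ χ₀ 0 * U χ x) (Icc 0 δ) :=
        continuousOn_const.mul ((hcont χ hχmem).mono (Icc_subset_Icc le_rfl hδlam))
      obtain ⟨ζ₀, hζ₀, hgζ₀⟩ :=
        intermediate_value_Ioo hδ.le hcontg (show (0 : ℝ) ∈ Ioo _ _ from ⟨hneg, hδpos⟩)
      have hζ₀Z : ζ₀ ∈ Zχ :=
        ⟨⟨hζ₀.1, lt_of_lt_of_le hζ₀.2 hδlam⟩, (mul_eq_zero.mp hgζ₀).resolve_left hs⟩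
      have hζ₀im : ζ₀ ∉ ζ '' F₀ := by
        rintro ⟨z, hz, hzζ⟩
        have h1 := (hζI z hz).1
        have h2 := hfar0 z hz
        rw [hzζ] at h1
        linarith [hζ₀.2]
      have hsub : insert ζ₀ (ζ '' F₀) ⊆ Zχ := by
        refine insert_subset hζ₀Z ?_
        rintro _ ⟨z, hz, rfl⟩
        exact hζZ z hz
      have hcard : (insert ζ₀ (ζ '' F₀)).ncard = F₀.ncard + 1 := by
        rw [ncard_insert_of_notMem hζ₀im (hF₀f.image ζ), hζinj.ncard_image]
      have hlower' : F₀.ncard + 1 ≤ Zχ.ncard := hcard ▸ ncard_le_ncard hsub hZχf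
      rw [hFcard] at hupper
      exact le_antisymm hupper hlower'

end Literature.NumberTheory.LFunctions
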